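import Mathlib
import Summits.Ventures.PercRepro2.K5HyperI

/-!
# THE (ii)-SIDE HYPEREDGE BASE TERMS, TYPE `1`
(blind cell PercRepro2, typer-1 g10; mine-1 §23.1 — `N(H + T(1)) ≥ 0`, the hyperedge of type `1` = the
triangle forced open in exactly one copy; twin `k5hyper_ii_base_typer.py`, `0` violations)

One `decide +kernel` per triangle `T = {a, b, c}`: `CertLE (sumT1 negOn D) (sumT1 posOn D)` — the (ii) count
being `pos − neg` (`K5Hyper.lean`), at every `K₅` profile.
-/

namespace Summit.Ventures.PercRepro2

namespace K5

set_option maxRecDepth 100000 in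
set_option maxHeartbeats 0 in
/-- `N(H + T(1)) ≥ 0` on the triangle `T = {0, 1, 2}`. -/
theorem cert_T1_012 : CertLE (sumT1 negOn (triMask 0 1 2)) (sumT1 posOn (triMask 0 1 2)) := by
  unfold CertLE
  decide +kernel

set_option maxRecDepth 100000 in
set_option maxHeartbeats 0 in
/-- `N(H + T(1)) ≥ 0` on the triangle `T = {0, 1, 3}`. -/
theorem cert_T1_013 : CertLE (sumT1 negOn (triMask 0 1 3)) (sumT1 posOn (triMask 0 1 3)) := by
  unfold CertLE
  decide +kernel

set_option maxRecDepth 100000 in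
set_option maxHeartbeats 0 in
/-- `N(H + T(1)) ≥ 0` on the triangle `T = {0, 1, 4}`. -/
theorem cert_T1_014 : CertLE (sumT1 negOn (triMask 0 1 4)) (sumT1 posOn (triMask 0 1 4)) := by
  unfold CertLE
  decide +kernel

set_option maxRecDepth 100000 in
set_option maxHeartbeats 0 in
/-- `N(H + T(1)) ≥ 0` on the triangle `T = {0, 2, 3}`. -/
theorem cert_T1_023 : CertLE (sumT1 negOn (triMask 0 2 3)) (sumT1 posOn (triMask 0 2 3)) := by
  unfold CertLE
  decide +kernel

set_option maxRecDepth 100000 in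
set_option maxHeartbeats 0 in
/-- `N(H + T(1)) ≥ 0` on the triangle `T = {0, 2, 4}`. -/
theorem cert_T1_024 : CertLE (sumT1 negOn (triMask 0 2 4)) (sumT1 posOn (triMask 0 2 4)) := by
  unfold CertLE
  decide +kernel

set_option maxRecDepth 100000 in
set_option maxHeartbeats 0 in
/-- `N(H + T(1)) ≥ 0` on the triangle `T = {0, 3, 4}`. -/
theorem cert_T1_034 : CertLE (sumT1 negOn (triMask 0 3 4)) (sumT1 posOn (triMask 0 3 4)) := by
  unfold CertLE
  decide +kernel

set_option maxRecDepth 100000 in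
set_option maxHeartbeats 0 in
/-- `N(H + T(1)) ≥ 0` on the triangle `T = {1, 2, 3}`. -/
theorem cert_T1_123 : CertLE (sumT1 negOn (triMask 1 2 3)) (sumT1 posOn (triMask 1 2 3)) := by
  unfold CertLE
  decide +kernel

set_option maxRecDepth 100000 in
set_option maxHeartbeats 0 in
/-- `N(H + T(1)) ≥ 0` on the triangle `T = {1, 2, 4}`. -/
theorem cert_T1_124 : CertLE (sumT1 negOn (triMask 1 2 4)) (sumT1 posOn (triMask 1 2 4)) := by
  unfold CertLE
  decide +kernel

set_option maxRecDepth 100000 in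
set_option maxHeartbeats 0 in
/-- `N(H + T(1)) ≥ 0` on the triangle `T = {1, 3, 4}`. -/
theorem cert_T1_134 : CertLE (sumT1 negOn (triMask 1 3 4)) (sumT1 posOn (triMask 1 3 4)) := by
  unfold CertLE
  decide +kernel

set_option maxRecDepth 100000 in
set_option maxHeartbeats 0 in
/-- `N(H + T(1)) ≥ 0` on the triangle `T = {2, 3, 4}`. -/
theorem cert_T1_234 : CertLE (sumT1 negOn (triMask 2 3 4)) (sumT1 posOn (triMask 2 3 4)) := by
  unfold CertLE
  decide +kernel

end K5

end Summit.Ventures.PercRepro2
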